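import Summits.CriticalPhenomena.CardyFormulaZ2.Theorems.CardySusyWardDiscretisationFamilyExistsInnerCells
import Literature.Topology.PlaneTopology.ArcGluing
import HarnessLib

/-!
# The exit arc of a leg, I: geometry of two adjacent cells and exit witnesses — helper for `DiscretisationFamilyExists` (stmt-CriticalPhenomena-9644)

The cross-cut leaves the union of inner cells through a face-boundary edge: from the centre `C` of
an inner cell `F = (k, j)` it heads for the centre `C'` of the adjacent NON-inner cell
`F' = (k', j')` through the midpoint `P*` of their common side, and on towards an exit witness
`w ∈ closure F'`, `w ∉ Ω` (a side point off `closure Ω` or a corner off `Ω`,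
`exists_witness_of_not_isInnerFace`), stopping at the FIRST point `c ∉ Ω`, which is a frontier
point.  `exists_exitArc` packages the resulting simple arc `X` from `C` to `c`: `X \\ {c} ⊆ Ω`,
`segment C P* ⊆ X ⊆ segment C C' ∪ closure F'`, `c ∈ closure F'`, and every point of `X` in `Ω`
lies on `segment C P*` or in the OPEN cell `F'` — the form in which the leg geometry files read off
box-, mesh- and edge-avoidance.  Elementary convexity of cells (`Mesh.cell`), first hits along
straight segments (`exists_first_hit`), and gluing of arcs (`IsSimpleArc.union`).
-/

noncomputable section

open Set Metric Complex
open Literature.Probability.LatticeModels Literature.Probability.Percolation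
  Literature.Probability.LatticeModels.Mesh Literature.Probability.LatticeModels.DiscreteDobrushin
  Literature.Topology.PlaneTopology

namespace Summit.CriticalPhenomena.CardyFormulaZ2.Theorems.DiscretisationFamilyExists

/-! ### Straight parametrisations -/

/-- The image of `[0, s]` under `θ ↦ x + θ (y - x)` is the segment from `x` to `x + s (y - x)`
(`s ≥ 0`). [folklore] -/
theorem image_param_Icc (x y : ℂ) {s : ℝ} (hs : 0 ≤ s) :
    (fun θ : ℝ => x + θ • (y - x)) '' Icc 0 s = segment ℝ x (x + s • (y - x)) := by
  rw [segment_eq_image']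
  ext z
  simp only [mem_image, mem_Icc, add_sub_cancel_left, smul_smul]
  constructor
  · rintro ⟨θ, ⟨h0, h1⟩, rfl⟩
    rcases eq_or_lt_of_le hs with rfl | hs'
    · refine ⟨0, ⟨le_rfl, zero_le_one⟩, ?_⟩
      have : θ = 0 := le_antisymm h1 h0
      simp [this]
    · refine ⟨θ / s, ⟨div_nonneg h0 hs, (div_le_one hs').2 h1⟩, ?_⟩
      rw [div_mul_cancel₀ _ hs'.ne']
  · rintro ⟨θ, ⟨h0, h1⟩, rfl⟩
    exact ⟨θ * s, ⟨mul_nonneg h0 hs, by nlinarith⟩, rfl⟩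

/-- `θ ↦ x + θ (y - x)` is continuous. [folklore] -/
theorem continuous_param (x y : ℂ) : Continuous fun θ : ℝ => x + θ • (y - x) := by fun_prop

/-- `θ ↦ x + θ (y - x)` is injective for `x ≠ y`. [folklore] -/
theorem injective_param {x y : ℂ} (hxy : x ≠ y) : Function.Injective fun θ : ℝ => x + θ • (y - x) := by
  intro a b h
  have h' : (a - b) • (y - x) = 0 := by
    rw [sub_smul]; exact sub_eq_zero.2 (add_left_cancel h)
  rcases smul_eq_zero.1 h' with h1 | h1
  · linarith
  · exact absurd (sub_eq_zero.1 h1).symm hxy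

/-! ### Geometry of two side-adjacent cells -/

/-- The centre of cell `(k, j)` shifted by half a mesh in an axis direction: the midpoint of the
segment to the centre of a side-adjacent cell lies in the closures of both cells, and the centres
differ by `δ` in exactly one coordinate. Stated through the four cases. [folklore] -/
theorem midpoint_mem_closure_of_adj {δ : ℝ} (hδ : 0 < δ) {k j k' j' : ℤ}
    (hadj : (k' = k ∧ (j' = j + 1 ∨ j' = j - 1)) ∨ (j' = j ∧ (k' = k + 1 ∨ k' = k - 1))) :
    (2⁻¹ : ℝ) • (cellCenter δ k j + cellCenter δ k' j') ∈ closure (cell δ k j) ∧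
    (2⁻¹ : ℝ) • (cellCenter δ k j + cellCenter δ k' j') ∈ closure (cell δ k' j') ∧
    ((|(cellCenter δ k' j' - cellCenter δ k j).re| = δ ∧ (cellCenter δ k' j' - cellCenter δ k j).im = 0) ∨
     ((cellCenter δ k' j' - cellCenter δ k j).re = 0 ∧ |(cellCenter δ k' j' - cellCenter δ k j).im| = δ)) := by
  rw [closure_cell hδ, closure_cell hδ, mem_reProdIm, mem_reProdIm]
  simp only [Complex.real_smul, mul_re, mul_im, ofReal_re, ofReal_im, add_re, add_im, sub_re, sub_im,
    cellCenter_re, cellCenter_im, zero_mul, sub_zero, add_zero, mem_Icc]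
  rcases hadj with ⟨rfl, rfl | rfl⟩ | ⟨rfl, rfl | rfl⟩ <;> push_cast <;>
    refine ⟨⟨⟨by nlinarith, by nlinarith⟩, by nlinarith, by nlinarith⟩,
      ⟨⟨by nlinarith, by nlinarith⟩, by nlinarith, by nlinarith⟩, ?_⟩
  · right; constructor
    · ring
    · rw [show δ * (↑j + 1 + 1 / 2) - δ * (↑j + 1 / 2) = δ by ring, abs_of_pos hδ]
  · right; constructor
    · ring
    · rw [show δ * (↑j - 1 + 1 / 2) - δ * (↑j + 1 / 2) = -δ by ring, abs_neg, abs_of_pos hδ]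
  · left; constructor
    · rw [show δ * (↑k + 1 + 1 / 2) - δ * (↑k + 1 / 2) = δ by ring, abs_of_pos hδ]
    · ring
  · left; constructor
    · rw [show δ * (↑k - 1 + 1 / 2) - δ * (↑k + 1 / 2) = -δ by ring, abs_neg, abs_of_pos hδ]
    · ring

/-- Points of the closed cell are within half a mesh of the centre in each coordinate. [folklore] -/
theorem abs_sub_cellCenter_le {δ : ℝ} (hδ : 0 < δ) {k j : ℤ} {z : ℂ} (hz : z ∈ closure (cell δ k j)) :
    |(z - cellCenter δ k j).re| ≤ δ / 2 ∧ |(z - cellCenter δ k j).im| ≤ δ / 2 := by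
  rw [closure_cell hδ, mem_reProdIm] at hz
  obtain ⟨⟨h1, h2⟩, h3, h4⟩ := hz
  rw [sub_re, sub_im, cellCenter_re, cellCenter_im, abs_le, abs_le]
  refine ⟨⟨by linarith, by linarith⟩, by linarith, by linarith⟩

/-- **The ray from the centre through a side midpoint leaves the closed cell at the midpoint.** If
`z` is in the closed cell `F'` and `z - C' = λ (P* - C')` with `λ ≥ 0`, where `P* - C'` is a
half-mesh axis vector, then `λ ≤ 1`. [folklore] -/
theorem le_one_of_mem_closure_of_eq_smul {δ : ℝ} (hδ : 0 < δ) {k' j' : ℤ} {z d : ℂ}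
    (hz : z ∈ closure (cell δ k' j'))
    (hd : (|d.re| = δ / 2 ∧ d.im = 0) ∨ (d.re = 0 ∧ |d.im| = δ / 2)) {t : ℝ} (ht : 0 ≤ t)
    (heq : z - cellCenter δ k' j' = t • d) : t ≤ 1 := by
  obtain ⟨hre, him⟩ := abs_sub_cellCenter_le hδ hz
  rw [heq] at hre him
  simp only [Complex.real_smul, mul_re, mul_im, ofReal_re, ofReal_im, zero_mul, sub_zero, add_zero,
    abs_mul, abs_of_nonneg ht] at hre him
  rcases hd with ⟨h, -⟩ | ⟨-, h⟩
  · rw [h] at hre; nlinarith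
  · rw [h] at him; nlinarith

/-- The closed cell `F` and the open side-adjacent cell `F'` are disjoint. [folklore] -/
theorem closure_cell_disjoint_cell_of_adj {δ : ℝ} (hδ : 0 < δ) {k j k' j' : ℤ}
    (hadj : (k' = k ∧ (j' = j + 1 ∨ j' = j - 1)) ∨ (j' = j ∧ (k' = k + 1 ∨ k' = k - 1))) :
    Disjoint (closure (cell δ k j)) (cell δ k' j') := by
  rw [Set.disjoint_left]
  intro z hz hz'
  rw [closure_cell hδ, mem_reProdIm] at hz
  rw [mem_cell_iff] at hz'
  obtain ⟨⟨h1, h2⟩, h3, h4⟩ := hz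
  obtain ⟨⟨h5, h6⟩, h7, h8⟩ := hz'
  rcases hadj with ⟨rfl, rfl | rfl⟩ | ⟨rfl, rfl | rfl⟩ <;> push_cast at * <;> nlinarith

/-- On the segment between the centres of two side-adjacent cells, the only point of the grid
lines is the midpoint. [folklore] -/
theorem eq_midpoint_of_mem_segment_of_mem_gridLines {δ : ℝ} (hδ : 0 < δ) {k j k' j' : ℤ}
    (hadj : (k' = k ∧ (j' = j + 1 ∨ j' = j - 1)) ∨ (j' = j ∧ (k' = k + 1 ∨ k' = k - 1))) {z : ℂ}
    (hz : z ∈ segment ℝ (cellCenter δ k j) (cellCenter δ k' j')) (hg : z ∈ gridLines δ) :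
    z = (2⁻¹ : ℝ) • (cellCenter δ k j + cellCenter δ k' j') := by
  rw [segment_eq_image'] at hz
  obtain ⟨θ, ⟨h0, h1⟩, rfl⟩ := hz
  -- a coordinate of the form `δ (n + 1/2)` is never an integer multiple of `δ`
  have key : ∀ (n m : ℤ), δ * (n + 1 / 2) ≠ δ * m := by
    intro n m h
    have h' : (n : ℝ) + 1 / 2 = m := by
      have := mul_left_cancel₀ hδ.ne' h
      exact_mod_cast this
    have h2 : (2 * n + 1 : ℤ) = 2 * m := by exact_mod_cast (by linarith : (2 * n + 1 : ℝ) = 2 * m)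
    omega
  -- and `δ (n + 1/2) + θ δ s = δ m` with `s = ±1`, `0 ≤ θ ≤ 1` forces `θ = 1/2`
  have key2 : ∀ (n m : ℤ) (s : ℝ), (s = 1 ∨ s = -1) → δ * (n + 1 / 2) + θ * (δ * s) = δ * m → θ = 1 / 2 := by
    intro n m s hs h
    have h' : (n : ℝ) + 1 / 2 + θ * s = m := by
      have : δ * ((n : ℝ) + 1 / 2 + θ * s) = δ * m := by rw [← h]; ring
      exact mul_left_cancel₀ hδ.ne' this
    rcases hs with rfl | rfl
    · -- `m - n ∈ (1/2, 3/2]`, an integer, hence `1`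
      have hlo : (0 : ℝ) < m - n := by linarith
      have hhi : (m : ℝ) - n < 2 := by linarith
      have h3 : m - n = 1 := by
        have a : (0 : ℤ) < m - n := by exact_mod_cast hlo
        have b : m - n < (2 : ℤ) := by exact_mod_cast hhi
        omega
      have : (m : ℝ) - n = 1 := by exact_mod_cast h3
      linarith
    · have hlo : (-1 : ℝ) < m - n := by linarith
      have hhi : (m : ℝ) - n < 1 := by linarith
      have h3 : m - n = 0 := by
        have a : (-1 : ℤ) < m - n := by exact_mod_cast hlo
        have b : m - n < (1 : ℤ) := by exact_mod_cast hhi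
        omega
      have : (m : ℝ) - n = 0 := by exact_mod_cast h3
      linarith
  have hθ : θ = 1 / 2 := by
    rcases hg with ⟨m, hm⟩ | ⟨m, hm⟩
    · simp only [add_re, Complex.real_smul, mul_re, ofReal_re, ofReal_im, zero_mul, sub_zero, sub_re,
        cellCenter_re] at hm
      rcases hadj with ⟨hk, hj | hj⟩ | ⟨hj, hk | hk⟩ <;> rw [hk] at hm
      · exfalso; exact key k m (by linarith)
      · exfalso; exact key k m (by linarith)
      · refine key2 k m 1 (Or.inl rfl) ?_; push_cast at hm ⊢; linarith
      · refine key2 k m (-1) (Or.inr rfl) ?_; push_cast at hm ⊢; linarith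
    · simp only [add_im, Complex.real_smul, mul_im, ofReal_re, ofReal_im, zero_mul, add_zero, sub_im,
        cellCenter_im] at hm
      rcases hadj with ⟨hk, hj | hj⟩ | ⟨hj, hk | hk⟩ <;> rw [hj] at hm
      · refine key2 j m 1 (Or.inl rfl) ?_; push_cast at hm ⊢; linarith
      · refine key2 j m (-1) (Or.inr rfl) ?_; push_cast at hm ⊢; linarith
      · exfalso; exact key j m (by linarith)
      · exfalso; exact key j m (by linarith)
  rw [hθ]
  simp only [smul_sub, smul_add, one_div]
  ring_nf
  simp only [Complex.real_smul]
  push_cast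
  ring

/-! ### Exit witnesses -/

/-- A half-integer multiple of `δ > 0` is not an integer multiple (instance of
`Mesh.ne_mul_int_of_mem_Ioo`; kept private, cf. `Mesh.half_ne_mul_int` of `MeshStrayParity.lean`,
not imported here). [folklore] -/
private theorem mul_add_half_ne_mul_int {δ : ℝ} (hδ : 0 < δ) (n m : ℤ) : δ * (n + 1 / 2) ≠ δ * m := by
  intro h
  have h' : (n : ℝ) + 1 / 2 = m := by exact_mod_cast mul_left_cancel₀ hδ.ne' h
  have h2 : (2 * n + 1 : ℤ) = 2 * m := by exact_mod_cast (by linarith : (2 * n + 1 : ℝ) = 2 * m)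
  omega

/-- The midpoint of the common side of two side-adjacent cells is not a mesh point. [folklore] -/
theorem meshPoint_ne_midpoint_of_adj {δ : ℝ} (hδ : 0 < δ) {k j k' j' : ℤ}
    (hadj : (k' = k ∧ (j' = j + 1 ∨ j' = j - 1)) ∨ (j' = j ∧ (k' = k + 1 ∨ k' = k - 1))) (x : Site 2) :
    meshPoint δ x ≠ (2⁻¹ : ℝ) • (cellCenter δ k j + cellCenter δ k' j') := by
  intro h
  rcases hadj with ⟨hk, -⟩ | ⟨hj, -⟩
  · have := congrArg Complex.re h
    rw [meshPoint_re, Complex.real_smul, mul_re, ofReal_re, ofReal_im, zero_mul, sub_zero, add_re,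
      cellCenter_re, cellCenter_re, hk] at this
    exact mul_add_half_ne_mul_int hδ k (x 0) (by linarith)
  · have := congrArg Complex.im h
    rw [meshPoint_im, Complex.real_smul, mul_im, ofReal_re, ofReal_im, zero_mul, add_zero, add_im,
      cellCenter_im, cellCenter_im, hj] at this
    exact mul_add_half_ne_mul_int hδ j (x 1) (by linarith)

/-- **An exit witness of a non-inner cell next to an inner one** (regular `Ω`): a point `w` of the
closed cell `F'` off `Ω`, on the grid lines and different from the midpoint `P*` of the common
side (a side point off `closure Ω`, or a corner off `Ω`; `exists_witness_of_not_isInnerFace`).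
[folklore] -/
theorem exists_exitWitness {E : DiscreteDobrushin} (hΩ : IsOpen E.Ω)
    (hJE : frontier E.Ω ⊆ closure (closure E.Ω)ᶜ) (hext : IsConnected (closure E.Ω)ᶜ)
    (hunb : ¬ Bornology.IsBounded (closure E.Ω)ᶜ) (hδ : 0 < E.δ) {k j k' j' : ℤ}
    (hF : E.IsInnerFace ![k, j]) (hF' : ¬ E.IsInnerFace ![k', j'])
    (hadj : (k' = k ∧ (j' = j + 1 ∨ j' = j - 1)) ∨ (j' = j ∧ (k' = k + 1 ∨ k' = k - 1))) :
    ∃ w : ℂ, w ∈ closure (cell E.δ k' j') ∧ w ∉ E.Ω ∧ w ∈ gridLines E.δ ∧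
      w ≠ (2⁻¹ : ℝ) • (cellCenter E.δ k j + cellCenter E.δ k' j') := by
  set δ := E.δ with hδdef
  -- a common corner, in `Ω_δ` as a corner of the inner cell
  have hcorner : ∃ x₀ : Site 2, IsCorner x₀ ![k, j] ∧ IsCorner x₀ ![k', j'] := by
    rcases hadj with ⟨hk, hj | hj⟩ | ⟨hj, hk | hk⟩
    · refine ⟨![k, j + 1], ?_, ?_⟩ <;> intro i <;> fin_cases i <;> simp <;> omega
    · refine ⟨![k, j], ?_, ?_⟩ <;> intro i <;> fin_cases i <;> simp <;> omega
    · refine ⟨![k + 1, j], ?_, ?_⟩ <;> intro i <;> fin_cases i <;> simp <;> omega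
    · refine ⟨![k, j], ?_, ?_⟩ <;> intro i <;> fin_cases i <;> simp <;> omega
  obtain ⟨x₀, hx₀F, hx₀F'⟩ := hcorner
  have hx₀D : x₀ ∈ meshDomain E.Ω δ := by
    obtain ⟨a, b, rfl⟩ := exists_corner_eq_of_isCorner hx₀F
    have hadj' : (zdGraph 2).Adj (corner ((![k, j] : Site 2) 0) ((![k, j] : Site 2) 1) a b)
        (corner ((![k, j] : Site 2) 0) ((![k, j] : Site 2) 1) (!a) b) := by
      cases a
      · exact zdGraph_adj_corner_horizontal _ _ b
      · exact (zdGraph_adj_corner_horizontal _ _ b).symm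
    exact (discreteDomainGraph_adj_iff.1
      (hF _ _ (isCorner_corner _ a b) (isCorner_corner _ (!a) b) hadj')).2.1
  have hPcl : (2⁻¹ : ℝ) • (cellCenter δ k j + cellCenter δ k' j') ∈ closure E.Ω :=
    closure_cell_subset_of_isInnerFace hΩ hJE hext hunb hδ hF
      (by simpa using (midpoint_mem_closure_of_adj hδ hadj).1)
  rcases exists_witness_of_not_isInnerFace hF' hx₀F' hx₀D with ⟨v, w, hv, hw, hvw, hseg⟩ | ⟨u, hu, huV⟩
  · obtain ⟨z, hz, hzcl⟩ := not_subset.1 hseg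
    obtain ⟨a, b, rfl⟩ := exists_corner_eq_of_isCorner hv
    obtain ⟨a', b', rfl⟩ := exists_corner_eq_of_isCorner hw
    refine ⟨z, ?_, fun h => hzcl (subset_closure h), segment_meshPoint_subset_gridLines δ hvw hz,
      fun h => hzcl (h ▸ hPcl)⟩
    have := segment_corner_subset_closure_cell hδ k' j' a b a' b'
    simp only [Matrix.cons_val_zero, Matrix.cons_val_one] at hz
    exact this (by simpa using hz)
  · obtain ⟨a, b, rfl⟩ := exists_corner_eq_of_isCorner hu
    refine ⟨meshPoint δ (corner ((![k', j'] : Site 2) 0) ((![k', j'] : Site 2) 1) a b), ?_, huV,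
      meshPoint_mem_gridLines δ _, meshPoint_ne_midpoint_of_adj hδ hadj _⟩
    simpa using meshPoint_corner_mem_closure_cell hδ k' j' a b

/-! ### The exit arc -/

/-- A point off `Ω` in `closure Ω` is a frontier point (`Ω` open). [folklore] -/
theorem mem_frontier_of_not_mem_of_mem_closure {Ω : Set ℂ} (hΩ : IsOpen Ω) {c : ℂ}
    (hc : c ∉ Ω) (hc' : c ∈ closure Ω) : c ∈ frontier Ω := by
  rw [frontier, hΩ.interior_eq]; exact ⟨hc', hc⟩

/-- Points of the straight parametrisation from `x` towards `y` before parameter `1/2` lie on the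
half-open segment `[x, (x+y)/2)`: `x + θ (y - x) = x + (2θ) ((x+y)/2 - x)`. [folklore] -/
theorem param_eq_param_midpoint (x y : ℂ) (θ : ℝ) :
    x + θ • (y - x) = x + (2 * θ) • ((2⁻¹ : ℝ) • (x + y) - x) := by
  simp only [Complex.real_smul]; push_cast; ring

/-- The same from the other end: `x + θ (y - x) = y + (2 (1 - θ)) ((x+y)/2 - y)`. [folklore] -/
theorem param_eq_param_midpoint' (x y : ℂ) (θ : ℝ) :
    x + θ • (y - x) = y + (2 * (1 - θ)) • ((2⁻¹ : ℝ) • (x + y) - y) := by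
  simp only [Complex.real_smul]; push_cast; ring

/-- The first hit is in the closure of the set travelled through before it. [folklore] -/
theorem mem_closure_of_before {η : ℝ → ℂ} (hη : Continuous η) {t₁ : ℝ} (ht₁ : 0 < t₁) {S : Set ℂ}
    (h : ∀ θ ∈ Ico (0 : ℝ) t₁, η θ ∈ S) : η t₁ ∈ closure S := by
  refine mem_closure_of_tendsto (b := nhdsWithin t₁ (Iio t₁))
    ((hη.tendsto t₁).mono_left nhdsWithin_le_nhds) ?_
  filter_upwards [Ico_mem_nhdsLT ht₁] with θ hθ using h θ hθ

/-- **The two pieces of the exit path meet only at the centre `C'`.** With `w` an exit witness of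
`F'` (in `closure F'`, on the grid lines, off the open cell… encoded as: `w ∈ gridLines`,
`w ≠ P*`), the segments `[C, C']` and `[C', w]` meet only in `C'`. [folklore] -/
theorem segment_inter_segment_witness {δ : ℝ} (hδ : 0 < δ) {k j k' j' : ℤ}
    (hadj : (k' = k ∧ (j' = j + 1 ∨ j' = j - 1)) ∨ (j' = j ∧ (k' = k + 1 ∨ k' = k - 1))) {w : ℂ}
    (hwF' : w ∈ closure (cell δ k' j')) (hwgrid : w ∈ gridLines δ)
    (hwP : w ≠ (2⁻¹ : ℝ) • (cellCenter δ k j + cellCenter δ k' j')) :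
    segment ℝ (cellCenter δ k j) (cellCenter δ k' j') ∩ segment ℝ (cellCenter δ k' j') w ⊆
      {cellCenter δ k' j'} := by
  obtain ⟨hPF, hPF', hdir⟩ := midpoint_mem_closure_of_adj hδ hadj
  have hgridP := fun z => eq_midpoint_of_mem_segment_of_mem_gridLines (δ := δ) hδ hadj (z := z)
  have hdisj := closure_cell_disjoint_cell_of_adj hδ hadj
  set C := cellCenter δ k j with hC
  set C' := cellCenter δ k' j' with hC'
  set Pstar := (2⁻¹ : ℝ) • (C + C') with hP
  have hCF : C ∈ cell δ k j := cellCenter_mem_cell hδ k j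
  have hC'F' : C' ∈ cell δ k' j' := cellCenter_mem_cell hδ k' j'
  have hwcell : w ∉ cell δ k' j' := fun h => cell_subset_compl_gridLines hδ k' j' h hwgrid
  have hC'w : C' ≠ w := fun h => hwcell (h ▸ hC'F')
  -- the direction `P* - C'` is a half-mesh axis vector
  have hd : (|(Pstar - C').re| = δ / 2 ∧ (Pstar - C').im = 0) ∨ ((Pstar - C').re = 0 ∧ |(Pstar - C').im| = δ / 2) := by
    have : Pstar - C' = (-(2⁻¹ : ℝ)) • (C' - C) := by
      rw [hP]; simp only [Complex.real_smul]; push_cast; ring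
    rw [this]
    simp only [Complex.real_smul, mul_re, mul_im, ofReal_re, ofReal_im, zero_mul, sub_zero, add_zero,
      abs_mul]
    rcases hdir with ⟨h1, h2⟩ | ⟨h1, h2⟩
    · left; rw [h1, h2]; norm_num; linarith
    · right; rw [h1, h2]; norm_num; linarith
  rintro z ⟨hz1, hz2⟩
  rw [mem_singleton_iff]
  rw [segment_eq_image'] at hz2
  obtain ⟨θ, ⟨hθ0, hθ1⟩, rfl⟩ := hz2
  rcases eq_or_lt_of_le hθ0 with h | hθ0'
  · rw [← h]; simp
  exfalso
  rcases eq_or_lt_of_le hθ1 with h | hθ1'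
  · -- `z = w` would lie on `[C, C']`, hence be `P*`
    refine hwP (hgridP _ ?_ hwgrid)
    simpa [h] using hz1
  -- `0 < θ < 1`: `z` is in the open cell `F'`
  have hzF' : C' + θ • (w - C') ∈ cell δ k' j' := by
    refine openSegment_subset_cell_of_mem_closure k' j' hC'F' hwF' ?_
    rw [openSegment_eq_image]
    refine ⟨θ, ⟨hθ0', hθ1'⟩, ?_⟩
    show (1 - θ) • C' + θ • w = C' + θ • (w - C')
    rw [smul_sub, sub_smul, one_smul]; abel
  rw [segment_eq_image'] at hz1
  obtain ⟨σ, ⟨hσ0, hσ1⟩, hσ⟩ := hz1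
  simp only [] at hσ
  -- `σ > 1/2`
  have hσhalf : 1 / 2 < σ := by
    by_contra h
    push Not at h
    rcases eq_or_lt_of_le h with h' | h'
    · -- `z = P*`
      have : C + σ • (C' - C) = Pstar := by rw [h', hP]; simp only [Complex.real_smul]; push_cast; ring
      have hPin : Pstar ∈ cell δ k' j' := by rw [← this, hσ]; exact hzF'
      exact Set.disjoint_left.1 hdisj hPF hPin
    · have hin : C + σ • (C' - C) ∈ cell δ k j := by
        rcases eq_or_lt_of_le hσ0 with h0 | h0
        · rw [← h0]; simpa using hCF
        · rw [param_eq_param_midpoint]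
          refine openSegment_subset_cell_of_mem_closure k j hCF hPF ?_
          rw [openSegment_eq_image]
          refine ⟨2 * σ, ⟨by linarith, by linarith⟩, ?_⟩
          show (1 - 2 * σ) • C + (2 * σ) • Pstar = C + (2 * σ) • (Pstar - C)
          rw [smul_sub, sub_smul, one_smul]; abel
      exact Set.disjoint_left.1 hdisj (subset_closure hin) (by rw [hσ]; exact hzF')
  -- write `z - C' = λ₁ (P* - C')` with `λ₁ = 2 (1 - σ) ∈ [0, 1)`, and `= θ (w - C')`
  have h1 : C + σ • (C' - C) - C' = (2 * (1 - σ)) • (Pstar - C') := by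
    rw [param_eq_param_midpoint']; abel
  have h2 : θ • (w - C') = (2 * (1 - σ)) • (Pstar - C') := by
    rw [← h1, hσ]; abel
  rcases eq_or_lt_of_le hσ1 with h | hσ1'
  · -- `σ = 1`: then `θ (w - C') = 0`, so `θ = 0`
    rw [h] at h2
    norm_num at h2
    rcases h2 with h2 | h2
    · linarith
    · exact hC'w (sub_eq_zero.1 h2).symm
  -- `w = C' + μ (P* - C')` with `μ = 2 (1 - σ) / θ > 0`; then `μ ≤ 1` and `w` is `P*` or in the open cell
  have hμ : w - C' = (2 * (1 - σ) / θ) • (Pstar - C') := by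
    have : w - C' = θ⁻¹ • (θ • (w - C')) := by rw [smul_smul, inv_mul_cancel₀ hθ0'.ne', one_smul]
    rw [this, h2, smul_smul, div_eq_inv_mul]
  have hμpos : 0 < 2 * (1 - σ) / θ := div_pos (by linarith) hθ0'
  have hμle := le_one_of_mem_closure_of_eq_smul hδ hwF' hd hμpos.le hμ
  rcases eq_or_lt_of_le hμle with h | h
  · refine hwP ?_
    have : w = C' + (2 * (1 - σ) / θ) • (Pstar - C') := by rw [← hμ]; abel
    rw [this, h, one_smul]; abel
  · refine hwcell (openSegment_subset_cell_of_mem_closure k' j' hC'F' hPF' ?_)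
    rw [openSegment_eq_image]
    refine ⟨2 * (1 - σ) / θ, ⟨hμpos, h⟩, ?_⟩
    show (1 - 2 * (1 - σ) / θ) • C' + (2 * (1 - σ) / θ) • Pstar = w
    have : w = C' + (2 * (1 - σ) / θ) • (Pstar - C') := by rw [← hμ]; abel
    rw [this, smul_sub, sub_smul, one_smul]; abel

end Summit.CriticalPhenomena.CardyFormulaZ2.Theorems.DiscretisationFamilyExists

end
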